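import Summits.MatrixMultiplication.MatrixMultiplication.Theorems.GradedDesignFamily.Negative.SubfieldCellTripleCapstone
import Summits.MatrixMultiplication.MatrixMultiplication.Theorems.GradedDesignFamily.Negative.SubfieldCellFibreSum
import Summits.MatrixMultiplication.MatrixMultiplication.Theorems.GradedDesignFamily.Negative.SubfieldCellNormalizerFibre
import Summits.MatrixMultiplication.MatrixMultiplication.Theorems.GradedDesignFamily.Negative.SubfieldCellTraceFibre
import Summits.MatrixMultiplication.MatrixMultiplication.Theorems.GradedDesignFamily.Negative.SubfieldCellSliceCount

/-!
# Subfield cell — FINAL CAPSTONE: the design stub S3 is FALSE, unconditionally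

Unit `b2b-lgcu-subfield` (gen 20), supporting `stmt-MatrixMultiplication-7610` (SUBFIELD.md §25).

`not_subfieldCell`: **`¬ S3`** — the subfield-cell design stub `stub_subfieldCell` of the line
`quadratic_extension_level_one_cell` (statement copied VERBATIM) is false, with NO literature
hypothesis: the Breuillard–Green–Tao product theorem used by `not_subfieldCell_of_BGT2011` is replaced
by three elementary counting lemmas on `S₀ = SL₂(ι k) ≤ SL₂(K)`, `|K| = |k|² = q²`:
(F1) `subfieldCell_twistedCentralizer_card_le`, (F2N) `subfieldCell_normalizerFibre_card_le`,
(D) `subfieldCell_sliceCount_le` ⟹ (F2') `traceFibre_card_le_of_sliceCount`, assembled by the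
fibre summation `tripleProductBound_of_counting_sq` into the triple-product bound (KL-P) and fed to
`not_subfieldCell_of_tripleProduct` ((KL-P) ⟹ structure of a design ⟹ footprint contradiction).
Intermediate conditional forms kept for the record: `not_subfieldCell_of_traceFibre` ((F2) → ¬S3),
`not_subfieldCell_of_sliceCount` ((D) → ¬S3).

HONEST FRAMING: this DECIDES one design stub of one skeleton line of the crux `GradedDesignFamily`
NEGATIVELY (the line is dead; the crux and the summit are untouched).  A theorem / verdict,
NOT summit progress.  Sorry-free, axioms = {propext, Classical.choice, Quot.sound}. [folklore]
-/

set_option linter.dupNamespace false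

open scoped Pointwise MatrixGroups

namespace Summit.MatrixMultiplication.MatrixMultiplication.Theorems.GradedDesignFamily.Negative

/-- **`(F2) → ¬S3`** (S3 verbatim; (F2) in the shape of `BGTFreePlan.F2`).  NOT summit progress.
[folklore] -/
theorem not_subfieldCell_of_traceFibre
    (hF2 : ∀ (k K : Type) [Field k] [Fintype k] [DecidableEq k] [Field K] [Fintype K] [DecidableEq K]
      (ι : k →+* K), Fintype.card K = Fintype.card k ^ 2 →
      ∀ b b' g : Matrix.SpecialLinearGroup (Fin 2) K,
        b ∉ Subgroup.normalizer (((Matrix.SpecialLinearGroup.map ι :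
            Matrix.SpecialLinearGroup (Fin 2) k →* Matrix.SpecialLinearGroup (Fin 2) K).range :
            Subgroup (Matrix.SpecialLinearGroup (Fin 2) K)) :
            Set (Matrix.SpecialLinearGroup (Fin 2) K)) →
        b' ∉ Subgroup.normalizer (((Matrix.SpecialLinearGroup.map ι :
            Matrix.SpecialLinearGroup (Fin 2) k →* Matrix.SpecialLinearGroup (Fin 2) K).range :
            Subgroup (Matrix.SpecialLinearGroup (Fin 2) K)) :
            Set (Matrix.SpecialLinearGroup (Fin 2) K)) →
        g ∉ Subgroup.normalizer (((Matrix.SpecialLinearGroup.map ι :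
            Matrix.SpecialLinearGroup (Fin 2) k →* Matrix.SpecialLinearGroup (Fin 2) K).range :
            Subgroup (Matrix.SpecialLinearGroup (Fin 2) K)) :
            Set (Matrix.SpecialLinearGroup (Fin 2) K)) →
        Nat.card {h : Matrix.SpecialLinearGroup (Fin 2) k //
          ∃ s ∈ (Matrix.SpecialLinearGroup.map ι :
              Matrix.SpecialLinearGroup (Fin 2) k →* Matrix.SpecialLinearGroup (Fin 2) K).range,
          ∃ s' ∈ (Matrix.SpecialLinearGroup.map ι :
              Matrix.SpecialLinearGroup (Fin 2) k →* Matrix.SpecialLinearGroup (Fin 2) K).range,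
            b * Matrix.SpecialLinearGroup.map ι h * b' = s * g * s'} ≤
          4 * Fintype.card k * (Fintype.card k + 1)) :
    ¬ (∃ c : ℝ, 0 < c ∧ ∀ N : ℕ, ∃ (k K : Type) (_ : Field k) (_ : Fintype k) (_ : DecidableEq k)
      (_ : Field K) (_ : Fintype K) (_ : DecidableEq K)
      (φ : Matrix.SpecialLinearGroup (Fin 2) k →* Matrix.GeneralLinearGroup (Fin 2) K),
      Function.Injective φ ∧ Fintype.card K = Fintype.card k ^ 2 ∧ N ≤ Fintype.card K ∧
      ∃ Y Z : Finset (Matrix.GeneralLinearGroup (Fin 2) K),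
        c * (Fintype.card K : ℝ) ^ (3 / 2 : ℝ) ≤ (Finset.univ.image φ).card ∧
        c * (Fintype.card K : ℝ) ^ (3 / 2 : ℝ) ≤ Y.card ∧
        c * (Fintype.card K : ℝ) ^ (3 / 2 : ℝ) ≤ Z.card ∧
        ∀ z₀ ∈ Z, ∃ cf : (Fin 2 → K) → (Fin 2 → K) → ℂ,
          ∀ a : Matrix.SpecialLinearGroup (Fin 2) k, ∀ y ∈ Y, ∀ y' ∈ Y, ∀ z ∈ Z,
            (∑ u : Fin 2 → K, cf u (((φ a * y * y'⁻¹ * z : Matrix.GeneralLinearGroup (Fin 2) K) :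
                Matrix (Fin 2) (Fin 2) K).mulVec u)) =
              if a = 1 ∧ y = y' ∧ z = z₀ then 1 else 0) :=
  not_subfieldCell_of_tripleProduct
    (tripleProductBound_of_counting subfieldCell_twistedCentralizer_card_le hF2
      subfieldCell_normalizerFibre_card_le)

/-- **(F1) + (F2') + (F2N) ⟹ (KL-P)** with `C₁ = C₂ = 16`, `q₀ = 1` — the variant of
`tripleProductBound_of_counting` with the (F2') bound `8q²` in place of `4q(q+1)`.  NOT summit
progress. [folklore] -/
theorem tripleProductBound_of_counting_sq
    (h₁ : ∀ (k K : Type) [Field k] [Fintype k] [DecidableEq k] [Field K] [Fintype K] [DecidableEq K]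
      (ι : k →+* K), Fintype.card K = Fintype.card k ^ 2 →
      ∀ g : Matrix.SpecialLinearGroup (Fin 2) K,
        g ∉ Subgroup.normalizer (((Matrix.SpecialLinearGroup.map ι :
            Matrix.SpecialLinearGroup (Fin 2) k →* Matrix.SpecialLinearGroup (Fin 2) K).range :
            Subgroup (Matrix.SpecialLinearGroup (Fin 2) K)) :
            Set (Matrix.SpecialLinearGroup (Fin 2) K)) →
        Nat.card {h : Matrix.SpecialLinearGroup (Fin 2) k //
          g⁻¹ * Matrix.SpecialLinearGroup.map ι h * g ∈ (Matrix.SpecialLinearGroup.map ι :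
            Matrix.SpecialLinearGroup (Fin 2) k →* Matrix.SpecialLinearGroup (Fin 2) K).range} ≤
          2 * Fintype.card k)
    (h₂ : ∀ (k K : Type) [Field k] [Fintype k] [DecidableEq k] [Field K] [Fintype K] [DecidableEq K]
      (ι : k →+* K), Fintype.card K = Fintype.card k ^ 2 →
      ∀ b b' g : Matrix.SpecialLinearGroup (Fin 2) K,
        b ∉ Subgroup.normalizer (((Matrix.SpecialLinearGroup.map ι :
            Matrix.SpecialLinearGroup (Fin 2) k →* Matrix.SpecialLinearGroup (Fin 2) K).range :
            Subgroup (Matrix.SpecialLinearGroup (Fin 2) K)) :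
            Set (Matrix.SpecialLinearGroup (Fin 2) K)) →
        b' ∉ Subgroup.normalizer (((Matrix.SpecialLinearGroup.map ι :
            Matrix.SpecialLinearGroup (Fin 2) k →* Matrix.SpecialLinearGroup (Fin 2) K).range :
            Subgroup (Matrix.SpecialLinearGroup (Fin 2) K)) :
            Set (Matrix.SpecialLinearGroup (Fin 2) K)) →
        g ∉ Subgroup.normalizer (((Matrix.SpecialLinearGroup.map ι :
            Matrix.SpecialLinearGroup (Fin 2) k →* Matrix.SpecialLinearGroup (Fin 2) K).range :
            Subgroup (Matrix.SpecialLinearGroup (Fin 2) K)) :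
            Set (Matrix.SpecialLinearGroup (Fin 2) K)) →
        Nat.card {h : Matrix.SpecialLinearGroup (Fin 2) k //
          ∃ s ∈ (Matrix.SpecialLinearGroup.map ι :
              Matrix.SpecialLinearGroup (Fin 2) k →* Matrix.SpecialLinearGroup (Fin 2) K).range,
          ∃ s' ∈ (Matrix.SpecialLinearGroup.map ι :
              Matrix.SpecialLinearGroup (Fin 2) k →* Matrix.SpecialLinearGroup (Fin 2) K).range,
            b * Matrix.SpecialLinearGroup.map ι h * b' = s * g * s'} ≤
          8 * Fintype.card k ^ 2)
    (h₃ : ∀ (k K : Type) [Field k] [Fintype k] [DecidableEq k] [Field K] [Fintype K] [DecidableEq K]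
      (ι : k →+* K), Fintype.card K = Fintype.card k ^ 2 →
      ∀ b b' : Matrix.SpecialLinearGroup (Fin 2) K,
        b ∉ Subgroup.normalizer (((Matrix.SpecialLinearGroup.map ι :
            Matrix.SpecialLinearGroup (Fin 2) k →* Matrix.SpecialLinearGroup (Fin 2) K).range :
            Subgroup (Matrix.SpecialLinearGroup (Fin 2) K)) :
            Set (Matrix.SpecialLinearGroup (Fin 2) K)) →
        b' ∉ Subgroup.normalizer (((Matrix.SpecialLinearGroup.map ι :
            Matrix.SpecialLinearGroup (Fin 2) k →* Matrix.SpecialLinearGroup (Fin 2) K).range :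
            Subgroup (Matrix.SpecialLinearGroup (Fin 2) K)) :
            Set (Matrix.SpecialLinearGroup (Fin 2) K)) →
        Nat.card {h : Matrix.SpecialLinearGroup (Fin 2) k //
          b * Matrix.SpecialLinearGroup.map ι h * b' ∈
            Subgroup.normalizer (((Matrix.SpecialLinearGroup.map ι :
              Matrix.SpecialLinearGroup (Fin 2) k →* Matrix.SpecialLinearGroup (Fin 2) K).range :
              Subgroup (Matrix.SpecialLinearGroup (Fin 2) K)) :
              Set (Matrix.SpecialLinearGroup (Fin 2) K))} ≤
          8 * Fintype.card k * (Fintype.card k + 1)) :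
    ∃ C₁ C₂ : ℝ, 0 < C₂ ∧ ∃ q₀ : ℕ,
      ∀ (k K : Type) [Field k] [Fintype k] [DecidableEq k] [Field K] [Fintype K] [DecidableEq K]
        (ι : k →+* K), Fintype.card K = Fintype.card k ^ 2 → q₀ ≤ Fintype.card k →
        ∀ (P : Finset (Matrix.SpecialLinearGroup (Fin 2) k))
          (b b' : Matrix.SpecialLinearGroup (Fin 2) K),
          b ∉ Subgroup.normalizer (((Matrix.SpecialLinearGroup.map ι :
              Matrix.SpecialLinearGroup (Fin 2) k →* Matrix.SpecialLinearGroup (Fin 2) K).range :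
              Subgroup (Matrix.SpecialLinearGroup (Fin 2) K)) :
              Set (Matrix.SpecialLinearGroup (Fin 2) K)) →
          b' ∉ Subgroup.normalizer (((Matrix.SpecialLinearGroup.map ι :
              Matrix.SpecialLinearGroup (Fin 2) k →* Matrix.SpecialLinearGroup (Fin 2) K).range :
              Subgroup (Matrix.SpecialLinearGroup (Fin 2) K)) :
              Set (Matrix.SpecialLinearGroup (Fin 2) K)) →
          (P.card : ℝ) * ((P.card : ℝ) - C₁ * (Fintype.card k : ℝ) ^ 2) * P.card ≤
            C₂ * (Fintype.card k : ℝ) ^ 3 *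
              ((P.image (Matrix.SpecialLinearGroup.map ι) * {b} *
                P.image (Matrix.SpecialLinearGroup.map ι) * {b'} *
                P.image (Matrix.SpecialLinearGroup.map ι)).card : ℝ) := by
  refine ⟨16, 16, by norm_num, 1, ?_⟩
  intro k K _ _ _ _ _ _ ι hK _hq P b b' hb hb'
  set q := Fintype.card k with hq
  set f : SL(2, k) →* SL(2, K) := Matrix.SpecialLinearGroup.map ι with hf
  set N := Subgroup.normalizer ((f.range : Subgroup SL(2, K)) : Set SL(2, K)) with hN
  have hSN : f.range ≤ N := Subgroup.le_normalizer
  have hcount := tripleProduct_fibre_count f (specialLinearGroup_map_injective ι) N hSN b b' P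
    (2 * q) (8 * q ^ 2) (8 * q * (q + 1))
    (fun w hw S hS => (card_le_natCard_subtype _ S hS).trans (h₁ k K ι hK w hw))
    (fun w hw S hS => (card_le_natCard_subtype _ S hS).trans (h₂ k K ι hK b b' w hb hb' hw))
    (fun S hS => (card_le_natCard_subtype _ S hS).trans (h₃ k K ι hK b b' hb hb'))
  -- real arithmetic
  set p : ℕ := P.card with hp
  set t : ℕ := (P.image f * {b} * P.image f * {b'} * P.image f).card with ht
  have hq1 : 1 ≤ q := _hq
  have hR : (p : ℝ) * p * p ≤ p * (8 * q * (q + 1)) * p + (2 * q) * (8 * q ^ 2) * t := by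
    exact_mod_cast hcount
  have hq' : (1 : ℝ) ≤ q := by exact_mod_cast hq1
  have hp0 : (0 : ℝ) ≤ p := Nat.cast_nonneg _
  have ht0 : (0 : ℝ) ≤ t := Nat.cast_nonneg _
  have e1 : (8 : ℝ) * q * (q + 1) ≤ 16 * q ^ 2 := by nlinarith
  have e2 : (2 : ℝ) * q * (8 * q ^ 2) ≤ 16 * q ^ 3 := by nlinarith
  calc (p : ℝ) * ((p : ℝ) - 16 * (q : ℝ) ^ 2) * p
      ≤ (p : ℝ) * ((p : ℝ) - 8 * q * (q + 1)) * p := by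
        have : (p : ℝ) * ((p : ℝ) - 16 * (q : ℝ) ^ 2) ≤ (p : ℝ) * ((p : ℝ) - 8 * q * (q + 1)) :=
          mul_le_mul_of_nonneg_left (by linarith) hp0
        exact mul_le_mul_of_nonneg_right this hp0
    _ = (p : ℝ) * p * p - p * (8 * q * (q + 1)) * p := by ring
    _ ≤ (2 * q) * (8 * q ^ 2) * t := by linarith
    _ ≤ 16 * (q : ℝ) ^ 3 * t := mul_le_mul_of_nonneg_right e2 ht0

/-- **`(D) → ¬S3`**: the design stub S3 is FALSE conditionally on the single slice count (D)
(shape of the hypothesis of `traceFibre_card_le_of_sliceCount`).  NOT summit progress. [folklore] -/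
theorem not_subfieldCell_of_sliceCount
    (hD : ∀ (k K : Type) [Field k] [Fintype k] [DecidableEq k] [Field K] [Fintype K] [DecidableEq K]
      (_ι : k →+* K), Fintype.card K = Fintype.card k ^ 2 →
      ∀ σ : K →+* K, (∀ x, σ x = x ^ Fintype.card k) →
      ∀ m : Matrix.SpecialLinearGroup (Fin 2) K, m ≠ 1 → m ≠ -1 → ∀ t c : K,
        Nat.card {X : Matrix.SpecialLinearGroup (Fin 2) K //
          Matrix.SpecialLinearGroup.map σ X = X⁻¹ ∧
          Matrix.trace (X : Matrix (Fin 2) (Fin 2) K) = t ∧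
          Matrix.trace ((m * X : Matrix.SpecialLinearGroup (Fin 2) K) :
            Matrix (Fin 2) (Fin 2) K) = c} ≤ 4 * Fintype.card k) :
    ¬ (∃ c : ℝ, 0 < c ∧ ∀ N : ℕ, ∃ (k K : Type) (_ : Field k) (_ : Fintype k) (_ : DecidableEq k)
      (_ : Field K) (_ : Fintype K) (_ : DecidableEq K)
      (φ : Matrix.SpecialLinearGroup (Fin 2) k →* Matrix.GeneralLinearGroup (Fin 2) K),
      Function.Injective φ ∧ Fintype.card K = Fintype.card k ^ 2 ∧ N ≤ Fintype.card K ∧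
      ∃ Y Z : Finset (Matrix.GeneralLinearGroup (Fin 2) K),
        c * (Fintype.card K : ℝ) ^ (3 / 2 : ℝ) ≤ (Finset.univ.image φ).card ∧
        c * (Fintype.card K : ℝ) ^ (3 / 2 : ℝ) ≤ Y.card ∧
        c * (Fintype.card K : ℝ) ^ (3 / 2 : ℝ) ≤ Z.card ∧
        ∀ z₀ ∈ Z, ∃ cf : (Fin 2 → K) → (Fin 2 → K) → ℂ,
          ∀ a : Matrix.SpecialLinearGroup (Fin 2) k, ∀ y ∈ Y, ∀ y' ∈ Y, ∀ z ∈ Z,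
            (∑ u : Fin 2 → K, cf u (((φ a * y * y'⁻¹ * z : Matrix.GeneralLinearGroup (Fin 2) K) :
                Matrix (Fin 2) (Fin 2) K).mulVec u)) =
              if a = 1 ∧ y = y' ∧ z = z₀ then 1 else 0) :=
  not_subfieldCell_of_tripleProduct
    (tripleProductBound_of_counting_sq subfieldCell_twistedCentralizer_card_le
      (traceFibre_card_le_of_sliceCount hD) subfieldCell_normalizerFibre_card_le)

/-- **`¬ S3` (unconditional).**  The subfield-cell design stub `stub_subfieldCell` — verbatim — is
FALSE.  NOT summit progress. [folklore] -/
theorem not_subfieldCell :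
    ¬ (∃ c : ℝ, 0 < c ∧ ∀ N : ℕ, ∃ (k K : Type) (_ : Field k) (_ : Fintype k) (_ : DecidableEq k)
      (_ : Field K) (_ : Fintype K) (_ : DecidableEq K)
      (φ : Matrix.SpecialLinearGroup (Fin 2) k →* Matrix.GeneralLinearGroup (Fin 2) K),
      Function.Injective φ ∧ Fintype.card K = Fintype.card k ^ 2 ∧ N ≤ Fintype.card K ∧
      ∃ Y Z : Finset (Matrix.GeneralLinearGroup (Fin 2) K),
        c * (Fintype.card K : ℝ) ^ (3 / 2 : ℝ) ≤ (Finset.univ.image φ).card ∧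
        c * (Fintype.card K : ℝ) ^ (3 / 2 : ℝ) ≤ Y.card ∧
        c * (Fintype.card K : ℝ) ^ (3 / 2 : ℝ) ≤ Z.card ∧
        ∀ z₀ ∈ Z, ∃ cf : (Fin 2 → K) → (Fin 2 → K) → ℂ,
          ∀ a : Matrix.SpecialLinearGroup (Fin 2) k, ∀ y ∈ Y, ∀ y' ∈ Y, ∀ z ∈ Z,
            (∑ u : Fin 2 → K, cf u (((φ a * y * y'⁻¹ * z : Matrix.GeneralLinearGroup (Fin 2) K) :
                Matrix (Fin 2) (Fin 2) K).mulVec u)) =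
              if a = 1 ∧ y = y' ∧ z = z₀ then 1 else 0) :=
  not_subfieldCell_of_sliceCount subfieldCell_sliceCount_le

end Summit.MatrixMultiplication.MatrixMultiplication.Theorems.GradedDesignFamily.Negative
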